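import Mathlib
import Summits.MatrixMultiplication.MatrixMultiplication.Theorems.SnSubsetDichotomyHyperoctahedralThresholdPatternRefl

/-!
# `SnSubsetDichotomy.HyperoctahedralThreshold` — deck twins: a colour symmetry and one non-crossing translate
# give a clean closed rung walk

Helper for crux `stmt-MatrixMultiplication-10883` (line `refutation-local-symmetry`, open core
`stub_poorRigidCore`; siege seat k21, variation "supply/tip dichotomy").

Setting (the line's vocabulary): three colours `μ 0, μ 1, μ 2 : Equiv.Perm (Fin n)`; a colour word
`z : List (Fin 3)` acts on the right, `x · z = z.foldl (fun v c => μ c v) x`; the trajectory of a fixed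
point `x` of `z` is `t ↦ x · z.take t`.  A COLOUR SYMMETRY is a permutation `θ` of `Fin n` commuting with
the three colours (`θ (μ c v) = μ c (θ v)`); in a connected host every colour symmetry `≠ 1` is
fixed-point-free, the group it generates acts freely, and the host is a regular cover of its quotient
("deck transformations").

* `DeckTwin.foldl_act_comm` — a colour symmetry commutes with the action of every word;
  `DeckTwin.fixed_apply` — it permutes the fixed points of every word;
  `DeckTwin.pattern_apply_iff` — a fixed point and its image have IDENTICAL self-coincidence patterns
  (so every `⟨θ⟩`-orbit inside `Fix z` lies in one pattern class: the formal version of crux NOTES §3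
  "automorphic vertices have equal views of all depths").
* `deckTwin_cleanWalk` — consequently a fixed point `x` of a cyclically reduced `z` and its translate
  `θ x` give clean closed-rung-walk data in the exact output format of the core (`k + 1 = |z|` rungs,
  all points outside `R`) as soon as the two trajectories do not CROSS, `x · z.take s ≠ θ (x · z.take t)`
  for all `s, t` (at `s = t` this is `θ x ≠ x`).  Compared with the landed `stub_patternTwin` (p107640),
  which needs a pattern class of size `≥ 2ℓ|R| + ℓ² + 2`, this needs ONE translate and a checkable
  non-crossing condition — the form in which small deck groups are used: for a deck group `⟨θ₀⟩ ≅ ℤ/p`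
  and a closed lift `x` of a base closed walk, `x · z.take s = θ₀^g (x · z.take t)` can only happen at a
  base self-coincidence `(s, t)` with sheet gap `g`, so any exponent `j` outside the (small) gap set makes
  `θ := θ₀ ^ j` admissible (k21 memo `k21_supply_tip_memo.md` §3: commutator walks on theta subgraphs have
  at most 6 gaps, whence every host with a colour symmetry of prime order `p ≥ 11` — and, by a certified
  finite check, `p = 5, 7` — has a clean closed rung walk with `O(log n)` rungs).

Pure finite combinatorics; the walk itself is produced by the landed `patternPair_cleanWalk`
(sibling file `…PatternRefl`, seat k20). [folklore / this line]
-/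

-- the project's summit namespace `Summit.MatrixMultiplication.MatrixMultiplication` repeats a component by design (D-0022)
set_option linter.dupNamespace false

namespace Summit.MatrixMultiplication.MatrixMultiplication.Theorems.HyperoctahedralThreshold

open Equiv

namespace DeckTwin

variable {n : ℕ}

/-- **A colour symmetry commutes with every word**: if `θ (μ c v) = μ c (θ v)` for all colours `c`, then
`(θ x) · w = θ (x · w)` for every colour word `w`. [folklore] -/
theorem foldl_act_comm (μ : Fin 3 → Perm (Fin n)) (θ : Perm (Fin n))
    (hθ : ∀ c v, θ (μ c v) = μ c (θ v)) :
    ∀ (w : List (Fin 3)) (x : Fin n),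
      w.foldl (fun v c => μ c v) (θ x) = θ (w.foldl (fun v c => μ c v) x) := by
  intro w
  induction w with
  | nil => intro x; rfl
  | cons c w ih =>
    intro x
    rw [List.foldl_cons, List.foldl_cons, ← hθ c x, ih]

/-- **A colour symmetry permutes the fixed points of every word**: `x · z = x → (θ x) · z = θ x`.
[folklore] -/
theorem fixed_apply (μ : Fin 3 → Perm (Fin n)) (θ : Perm (Fin n))
    (hθ : ∀ c v, θ (μ c v) = μ c (θ v)) (z : List (Fin 3)) (x : Fin n)
    (hfx : z.foldl (fun v c => μ c v) x = x) :
    z.foldl (fun v c => μ c v) (θ x) = θ x := by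
  rw [foldl_act_comm μ θ hθ z x, hfx]

/-- **Translates have identical self-coincidence patterns**: for a colour symmetry `θ`, the trajectories of
`x` and `θ x` under any word coincide at the same pairs of positions,
`(θ x) · z.take s = (θ x) · z.take t ↔ x · z.take s = x · z.take t`. [folklore] -/
theorem pattern_apply_iff (μ : Fin 3 → Perm (Fin n)) (θ : Perm (Fin n))
    (hθ : ∀ c v, θ (μ c v) = μ c (θ v)) (z : List (Fin 3)) (x : Fin n) (s t : ℕ) :
    (z.take s).foldl (fun v c => μ c v) (θ x) = (z.take t).foldl (fun v c => μ c v) (θ x) ↔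
      (z.take s).foldl (fun v c => μ c v) x = (z.take t).foldl (fun v c => μ c v) x := by
  rw [foldl_act_comm μ θ hθ (z.take s) x, foldl_act_comm μ θ hθ (z.take t) x]
  exact θ.injective.eq_iff

end DeckTwin

open DeckTwin in
/-- **Deck twins give a clean closed rung walk.**  Let `μ c` be permutations of `Fin n`, `θ` a colour
symmetry (`θ (μ c v) = μ c (θ v)` for all `c, v`), `z` a cyclically reduced colour word of length `ℓ ≥ 2`
and `x` a fixed point of `z` whose trajectory and whose translated trajectory `t ↦ θ (x · z.take t)` avoid
`R`.  If the two trajectories never CROSS — `x · z.take s ≠ θ (x · z.take t)` for all `s, t < ℓ` (for a deck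
group `⟨θ₀⟩` this says: the exponent of `θ = θ₀^j` is not a sheet gap of a base self-coincidence) — then
`p t := x · z.take t`, `q t := (θ x) · z.take t`, `col t := z[t]` is clean closed-rung-walk data in the
output format of the line's open core `stub_poorRigidCore`: `k + 1 = ℓ` rungs with distinct ends,
side-preserving steps, cyclically distinct consecutive colours, pairwise equal-or-disjoint rungs, all points
outside `R`.  Proof: `θ x` is again a fixed point (`DeckTwin.fixed_apply`) with the same pattern
(`DeckTwin.pattern_apply_iff`), and the landed `patternPair_cleanWalk` applies. [this line, k21 memo §3] -/
theorem deckTwin_cleanWalk (n : ℕ) (μ : Fin 3 → Equiv.Perm (Fin n)) (R : Finset (Fin n))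
    (θ : Equiv.Perm (Fin n)) (hθ : ∀ c v, θ (μ c v) = μ c (θ v))
    (z : List (Fin 3)) (x : Fin n) (hlen : 2 ≤ z.length) (hchain : List.IsChain (· ≠ ·) (z ++ z))
    (hfx : z.foldl (fun v c => μ c v) x = x)
    (hcross : ∀ s t : Fin z.length,
      (z.take (s : ℕ)).foldl (fun v c => μ c v) x ≠ θ ((z.take (t : ℕ)).foldl (fun v c => μ c v) x))
    (hRx : ∀ t : Fin z.length, (z.take (t : ℕ)).foldl (fun v c => μ c v) x ∉ R)
    (hRθ : ∀ t : Fin z.length, θ ((z.take (t : ℕ)).foldl (fun v c => μ c v) x) ∉ R) :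
    ∃ (k : ℕ) (p q : Fin (k + 1) → Fin n) (col : Fin (k + 1) → Fin 3), (∀ i, p i ≠ q i) ∧
      (∀ i, (μ (col i) (p i) = p (i + 1) ∧ μ (col i) (q i) = q (i + 1)) ∨
        (μ (col i) (p i) = q (i + 1) ∧ μ (col i) (q i) = p (i + 1))) ∧
      (∀ i, col i ≠ col (i + 1)) ∧
      (∀ i j, (p i = p j ∧ q i = q j) ∨ (p i = q j ∧ q i = p j) ∨
        (p i ≠ p j ∧ p i ≠ q j ∧ q i ≠ p j ∧ q i ≠ q j)) ∧
      (∀ i, p i ∉ R ∧ q i ∉ R) ∧ k + 1 = z.length := by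
  refine patternPair_cleanWalk n μ R z x (θ x) hlen hchain hfx (fixed_apply μ θ hθ z x hfx)
    (fun s t => (pattern_apply_iff μ θ hθ z x s t).symm) ?_ hRx ?_
  · intro s t
    rw [foldl_act_comm μ θ hθ (z.take (t : ℕ)) x]
    exact hcross s t
  · intro t
    rw [foldl_act_comm μ θ hθ (z.take (t : ℕ)) x]
    exact hRθ t

/-- **Registered-style form `stub_deckTwin`** (crux `stmt-MatrixMultiplication-10883`, helper of siege seat k21):
`deckTwin_cleanWalk` with all hypotheses spelled out, in the conventions of the line's registered stubs.
[this line] -/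
theorem stub_deckTwin : ∀ (n : ℕ) (μ : Fin 3 → Equiv.Perm (Fin n)) (R : Finset (Fin n)) (θ : Equiv.Perm (Fin n)) (z : List (Fin 3)) (x : Fin n), (∀ c v, θ (μ c v) = μ c (θ v)) → 2 ≤ z.length → List.IsChain (· ≠ ·) (z ++ z) → z.foldl (fun v c => μ c v) x = x → (∀ s t : Fin z.length, (z.take (s : ℕ)).foldl (fun v c => μ c v) x ≠ θ ((z.take (t : ℕ)).foldl (fun v c => μ c v) x)) → (∀ t : Fin z.length, (z.take (t : ℕ)).foldl (fun v c => μ c v) x ∉ R) → (∀ t : Fin z.length, θ ((z.take (t : ℕ)).foldl (fun v c => μ c v) x) ∉ R) → ∃ (k : ℕ) (p q : Fin (k + 1) → Fin n) (col : Fin (k + 1) → Fin 3), (∀ i, p i ≠ q i) ∧ (∀ i, (μ (col i) (p i) = p (i + 1) ∧ μ (col i) (q i) = q (i + 1)) ∨ (μ (col i) (p i) = q (i + 1) ∧ μ (col i) (q i) = p (i + 1))) ∧ (∀ i, col i ≠ col (i + 1)) ∧ (∀ i j, (p i = p j ∧ q i = q j) ∨ (p i = q j ∧ q i = p j) ∨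 (p i ≠ p j ∧ p i ≠ q j ∧ q i ≠ p j ∧ q i ≠ q j)) ∧ (∀ i, p i ∉ R ∧ q i ∉ R) ∧ k + 1 = z.length :=
  fun n μ R θ z x hθ hlen hchain hfx hcross hRx hRθ =>
    deckTwin_cleanWalk n μ R θ hθ z x hlen hchain hfx hcross hRx hRθ

end Summit.MatrixMultiplication.MatrixMultiplication.Theorems.HyperoctahedralThreshold
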